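import Mathlib.Topology.Algebra.Module.Cardinality
import Literature.MathematicalPhysics.QuantumFieldTheory.PointwiseOSReconstruction
import Literature.Probability.LatticeModels.ScalingLimit3D
import Summits.CriticalPhenomena.Ising3DConformalLimit.Theses.HyperoctahedralRP
import HarnessLib

/-!
# Reflection positivity of pointwise scaling limits of the critical `ℤ³` correlators: stub
# `stub_osReflectionPositive` of line `free-endpoint-gaussian-closure` for crux
# `InversionUpgradeNormalised` (stmt-CriticalPhenomena-1982)

Statement.  Assume site-mirror reflection positivity of the critical Ising correlators
`criticalCorr 3` through the three coordinate planes `{k_τ = 0}` of `ℤ³` (the statement of the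
landed stub `stub_latticeRP`: for lattice configurations `z^a` in the closed half-lattice
`{k_τ ≥ 0}` and reals `c_a`, `Σ_{a,b} c_a c_b ⟨∏ σ_{θ z^a ++ z^b}⟩_{β_c} ≥ 0`, `θ` negating the
`τ`-th coordinate).  Then every translation-invariant pointwise scaling limit `S` of
`criticalCorr 3` (`HasPointwiseScalingLimit (criticalCorr 3) ρ S`) is reflection positive along
each axis `τ` in the pointwise Osterwalder–Schrader sense `IsReflectionPositiveAlong τ S`
(Glimm–Jaffe 1987, §6.1, (OS3): `Σ_{i,j} c_i c_j S(θ_τ a_i, a_j) ≥ 0` for half-space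
configurations `a_i` of `{x_τ > 0}`).

Proof (the HALF-MESH DIAGONAL SHIFT; no continuity of `S` is used).  Fix half-space
configurations `a_1, …, a_k`, reals `c`, and put `Z_{ij} = (θ_τ a_i, a_j)` (non-coincident) and
`Z^δ_{ij} = Z_{ij} + (δ/2)(e_τ, …, e_τ)`.
* Lattice symmetry: for `δ > 0` off the countable set
  `{p_τ / (m - ½) : m ∈ ℤ, p a point of some a_i}` the number `w = p_τ/δ + ½` is not an integer,
  so `⌊-p_τ/δ + ½⌋ = ⌊1 - w⌋ = -⌊w⌋` (`floor_neg_add_half`); hence the lattice approximation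
  `[Z^δ_{ij}/δ]` is EXACTLY the site mirror of `[a^δ_i/δ]` concatenated with `[a^δ_j/δ]`, all in
  the closed half-lattice (`latticeApprox_axisReflection_add_halfMesh`,
  `latticeApprox_add_halfMesh_nonneg`), and the hypothesis with coefficients `c_i ρ(δ)^{n_i}`
  gives `Σ c_i c_j ρ^{n_i+n_j} G([Z^δ_{ij}/δ]) ≥ 0`.
* Limit: `S(Z^δ_{ij}) = S(Z_{ij})` by translation invariance, and locally uniform convergence on
  the open set of non-coincident configurations at the moving point `Z^δ_{ij} → Z_{ij}` gives
  `ρ^{n_i+n_j} G([Z^δ_{ij}/δ]) → S(Z_{ij})` (`tendsto_of_tendstoLocallyUniformlyOn_of_apply_eq`).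
* A countable set has dense complement in `ℝ` (`Set.Countable.dense_compl`), so the shifted
  double sum is `≥ 0` frequently along `𝓝[>] 0`, and `ge_of_tendsto_of_frequently` concludes.

References: J. Glimm, A. Jaffe, *Quantum Physics* (2nd ed., Springer 1987), §6.1 (OS3),
(6.1.8)–(6.1.9); J. Fröhlich, R. Israel, E. H. Lieb, B. Simon, Comm. Math. Phys. 62 (1978) 1–34,
§2 (reflection positivity through sites). No definitions are introduced.
-/

noncomputable section

open Filter Topology
open Literature.Probability.LatticeModels Literature.MathematicalPhysics.QuantumFieldTheory

namespace Summit.CriticalPhenomena.Ising3DConformalLimit.Cruxes.InversionUpgradeNormalised.FreeEndpointGaussianClosure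

/-! ### Rounding to the nearest integer is odd off the half-integers -/

/-- Off the integers the nearest-integer rounding `u ↦ ⌊u + ½⌋` is odd:
`⌊-u + ½⌋ = -⌊u + ½⌋` whenever `u + ½ ∉ ℤ`. -/
theorem floor_neg_add_half {u : ℝ} (h : ∀ m : ℤ, u + 1 / 2 ≠ m) :
    ⌊-u + 1 / 2⌋ = -⌊u + 1 / 2⌋ := by
  rw [Int.floor_eq_iff]
  have h1 := Int.floor_le (u + 1 / 2)
  have h2 := Int.lt_floor_add_one (u + 1 / 2)
  have h3 : (⌊u + 1 / 2⌋ : ℝ) < u + 1 / 2 := lt_of_le_of_ne h1 fun h' => h _ h'.symm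
  push_cast
  constructor <;> linarith

variable {d : ℕ}

/-- **Lattice symmetry of the half-mesh shifted approximation.**  For `δ ≠ 0` and a point `p`
with `p_τ/δ + ½ ∉ ℤ`, the lattice approximation `[·/δ]` of the shifted reflected point
`θ_τ p + (δ/2) e_τ` is the site mirror (negation of the `τ`-th coordinate) of the lattice
approximation of the shifted point `p + (δ/2) e_τ`. -/
theorem latticeApprox_axisReflection_add_halfMesh (τ : Fin d) (p : EuclideanSpace ℝ (Fin d))
    {δ : ℝ} (hδ : δ ≠ 0) (hp : ∀ m : ℤ, p τ / δ + 1 / 2 ≠ m) :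
    latticeApprox δ (axisReflection τ p + (δ / 2) • EuclideanSpace.single τ (1 : ℝ)) =
      Function.update (latticeApprox δ (p + (δ / 2) • EuclideanSpace.single τ (1 : ℝ))) τ
        (-(latticeApprox δ (p + (δ / 2) • EuclideanSpace.single τ (1 : ℝ)) τ)) := by
  funext i
  by_cases hi : i = τ
  · subst hi
    simp only [Function.update_self, latticeApprox_apply, PiLp.add_apply, PiLp.smul_apply,
      PiLp.single_eq_same, smul_eq_mul, mul_one]
    rw [axisReflection_apply, if_pos rfl,
      show (-p i + δ / 2) / δ = -(p i / δ) + 1 / 2 by field_simp,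
      show (p i + δ / 2) / δ = p i / δ + 1 / 2 by field_simp]
    exact floor_neg_add_half hp
  · simp only [Function.update_of_ne hi, latticeApprox_apply, PiLp.add_apply, PiLp.smul_apply,
      PiLp.single_apply, if_neg hi, axisReflection_apply, smul_eq_mul, mul_zero, add_zero]

/-- For `δ > 0` the half-mesh shifted approximation of a point of the open half-space `{p_τ > 0}`
lies in the closed half-lattice `{k_τ ≥ 0}`. -/
theorem latticeApprox_add_halfMesh_nonneg (τ : Fin d) {p : EuclideanSpace ℝ (Fin d)}
    (hp : 0 < p τ) {δ : ℝ} (hδ : 0 < δ) :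
    0 ≤ latticeApprox δ (p + (δ / 2) • EuclideanSpace.single τ (1 : ℝ)) τ := by
  simp only [latticeApprox_apply, PiLp.add_apply, PiLp.smul_apply, PiLp.single_eq_same,
    smul_eq_mul, mul_one]
  exact Int.floor_nonneg.mpr (by positivity)

/-! ### Moving-point limits under locally uniform convergence -/

/-- If `F_n → f` locally uniformly on `s`, `g_n → x ∈ s` within `s`, and `f (g_n) = f x` for
every `n`, then `F_n (g_n) → f x`: the composition lemma `TendstoLocallyUniformlyOn.tendsto_comp`
with continuity of `f` at `x` replaced by constancy of `f` along `g`. -/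
theorem tendsto_of_tendstoLocallyUniformlyOn_of_apply_eq {ι β : Type*} [TopologicalSpace β]
    {F : ι → β → ℝ} {f : β → ℝ} {p : Filter ι} {s : Set β}
    (h : TendstoLocallyUniformlyOn F f p s) {x : β} (hx : x ∈ s) {g : ι → β}
    (hg : Tendsto g p (𝓝[s] x)) (hfg : ∀ n, f (g n) = f x) :
    Tendsto (fun n => F n (g n)) p (𝓝 (f x)) := by
  refine Metric.tendsto_nhds.2 fun ε hε => ?_
  obtain ⟨t, ht, hev⟩ := Metric.tendstoLocallyUniformlyOn_iff.1 h ε hε x hx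
  filter_upwards [hev, hg ht] with n hn hn'
  rw [dist_comm, ← hfg n]
  exact hn _ hn'

/-! ### The registered stub -/

/-- **stub_osReflectionPositive** (OS reflection positivity of the scaling limit, Glimm–Jaffe
1987 §6.1 (OS3), from FILS 1978 §2).  Given site-mirror reflection positivity of `criticalCorr 3`
through the coordinate planes `{k_τ = 0}` (the statement of `stub_latticeRP`), every
translation-invariant pointwise scaling limit `S` of `criticalCorr 3` under a renormalisation `ρ`
(positive on `(0,1]`; positivity is not used) is reflection positive along every axis `τ`:
`Σ_{i,j} c_i c_j S(θ_τ a_i, a_j) ≥ 0` for half-space configurations `a_i`.  Proof by the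
half-mesh diagonal shift `Z ↦ Z + (δ/2) e_τ`, under which `[·/δ]` is exactly mirror symmetric for
every `δ` off a countable set and to which `S` is blind by translation invariance; the lattice
inequality passes to the limit along the moving points by locally uniform convergence,
frequently in `𝓝[>] 0` (`Set.Countable.dense_compl`, `ge_of_tendsto_of_frequently`). -/
theorem stub_osReflectionPositive :
    (∀ (τ : Fin 3) (m : ℕ) (k : Fin m → ℕ) (z : (a : Fin m) → Fin (k a) → Site 3) (c : Fin m → ℝ),
      (∀ a i, 0 ≤ z a i τ) →
      0 ≤ ∑ a, ∑ b, c a * c b *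
        criticalCorr 3 (k a + k b)
          (Fin.append (fun i => Function.update (z a i) τ (-(z a i τ))) (z b))) →
    ∀ (ρ : ℝ → ℝ) (S : CorrFamily 3), (∀ δ ∈ Set.Ioc (0:ℝ) 1, 0 < ρ δ) →
      HasPointwiseScalingLimit (criticalCorr 3) ρ S → IsTranslationInvariant S →
      ∀ τ : Fin 3, IsReflectionPositiveAlong τ S := by
  intro hRP ρ S _ hlim htr τ k a c
  -- the half-mesh shift `(δ/2) e_τ → 0` as `δ → 0⁺`
  set e : EuclideanSpace ℝ (Fin 3) := EuclideanSpace.single τ (1 : ℝ)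
  have hv : Tendsto (fun δ : ℝ => (δ / 2) • e) (𝓝[>] 0) (𝓝 0) := by
    have hc : Continuous fun δ : ℝ => (δ / 2) • e :=
      (continuous_id.div_const 2).smul continuous_const
    simpa using (hc.tendsto 0).mono_left nhdsWithin_le_nhds
  -- (3) the shifted double sum tends to the OS form
  have hlimΦ : Tendsto (fun δ : ℝ => ∑ i, ∑ j, c i * c j *
      rescaledCorrelator (criticalCorr 3) ρ ((a i).n + (a j).n) δ
        (fun l => Fin.append (fun l => axisReflection τ ((a i).pts l)) (a j).pts l +
          (δ / 2) • e))
      (𝓝[>] 0) (𝓝 (∑ i, ∑ j, c i * c j * osPointKernel S (a i) (a j))) := by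
    refine tendsto_finsetSum _ fun i _ => tendsto_finsetSum _ fun j _ => ?_
    refine Tendsto.const_mul _ ?_
    have hZ := osPointKernel_arg_injective (a i) (a j)
    have hg : Tendsto
        (fun δ : ℝ => fun l => Fin.append (fun l => axisReflection τ ((a i).pts l)) (a j).pts l +
          (δ / 2) • e) (𝓝[>] 0)
        (𝓝[NonCoincident 3 ((a i).n + (a j).n)]
          (Fin.append (fun l => axisReflection τ ((a i).pts l)) (a j).pts)) := by
      refine tendsto_nhdsWithin_iff.2
        ⟨tendsto_pi_nhds.2 fun l => ?_, Eventually.of_forall fun δ => ?_⟩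
      · simpa using
          hv.const_add (Fin.append (fun l => axisReflection τ ((a i).pts l)) (a j).pts l)
      · exact (add_left_injective _).comp hZ
    exact tendsto_of_tendstoLocallyUniformlyOn_of_apply_eq (hlim _) hZ hg fun δ => htr _ _ _
  -- (2) positivity of the shifted double sum off the countable bad set
  set Bad : Set ℝ := Set.range fun q : (Σ i : Fin k, Fin (a i).n) × ℤ =>
    (a q.1.1).pts q.1.2 τ / ((q.2 : ℝ) - 1 / 2)
  have hBad : Bad.Countable := Set.countable_range _
  have hgood : ∀ δ : ℝ, 0 < δ → δ ∉ Bad → 0 ≤ ∑ i, ∑ j, c i * c j *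
      rescaledCorrelator (criticalCorr 3) ρ ((a i).n + (a j).n) δ
        (fun l => Fin.append (fun l => axisReflection τ ((a i).pts l)) (a j).pts l +
          (δ / 2) • e) := by
    intro δ hδ hδB
    -- `δ` is good: no `p_τ/δ + ½` is an integer
    have hfrac : ∀ (i : Fin k) (l : Fin (a i).n) (m : ℤ),
        (a i).pts l τ / δ + 1 / 2 ≠ m := by
      intro i l m hm
      refine hδB (Set.mem_range.2 ⟨(⟨i, l⟩, m), ?_⟩)
      have hm0 : (m : ℝ) - 1 / 2 ≠ 0 := by
        intro h0
        have h1 : (2 * m : ℤ) = 1 := by exact_mod_cast (by linarith : (2 * m : ℝ) = 1)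
        omega
      have h1 : (a i).pts l τ / δ = m - 1 / 2 := by linarith
      rw [div_eq_iff hδ.ne'] at h1
      change (a i).pts l τ / ((m : ℝ) - 1 / 2) = δ
      rw [div_eq_iff hm0, h1, mul_comm]
    -- the shifted lattice configurations, in the closed half-lattice
    set w : (i : Fin k) → Fin (a i).n → Site 3 :=
      fun i l => latticeApprox δ ((a i).pts l + (δ / 2) • e)
    have hwpos : ∀ i l, 0 ≤ w i l τ := fun i l =>
      latticeApprox_add_halfMesh_nonneg τ ((a i).pos l) hδ
    -- exact mirror symmetry of the shifted approximations
    have hcfg : ∀ i j : Fin k,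
        (fun l => latticeApprox δ
          (Fin.append (fun l => axisReflection τ ((a i).pts l)) (a j).pts l + (δ / 2) • e)) =
          Fin.append (fun l => Function.update (w i l) τ (-(w i l τ))) (w j) := by
      intro i j
      change (fun q => latticeApprox δ (q + (δ / 2) • e)) ∘ Fin.append _ _ = _
      rw [comp_fin_append]
      refine congrArg₂ Fin.append (funext fun l => ?_) rfl
      exact latticeApprox_axisReflection_add_halfMesh τ ((a i).pts l) hδ.ne' (hfrac i l)
    -- the lattice inequality with coefficients `c_i ρ(δ)^{n_i}`
    have key : 0 ≤ ∑ i, ∑ j, (c i * ρ δ ^ (a i).n) * (c j * ρ δ ^ (a j).n) *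
        criticalCorr 3 ((a i).n + (a j).n)
          (Fin.append (fun l => Function.update (w i l) τ (-(w i l τ))) (w j)) :=
      hRP τ k (fun i => (a i).n) w (fun i => c i * ρ δ ^ (a i).n) hwpos
    refine key.trans_eq (Finset.sum_congr rfl fun i _ => Finset.sum_congr rfl fun j _ => ?_)
    rw [rescaledCorrelator_apply, hcfg i j, pow_add]
    ring
  -- (4) conclusion: the good meshes are frequent in `𝓝[>] 0`
  refine ge_of_tendsto_of_frequently hlimΦ ?_
  rw [Filter.frequently_iff]
  intro U hU
  obtain ⟨u, hu, hsub⟩ := mem_nhdsGT_iff_exists_Ioo_subset.1 hU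
  obtain ⟨δ, hδB, hδu⟩ :=
    (hBad.dense_compl ℝ).exists_mem_open isOpen_Ioo (Set.nonempty_Ioo.2 hu)
  exact ⟨δ, hsub hδu, hgood δ hδu.1 hδB⟩

end Summit.CriticalPhenomena.Ising3DConformalLimit.Cruxes.InversionUpgradeNormalised.FreeEndpointGaussianClosure

end
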